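import Mathlib.Analysis.InnerProductSpace.PiL2
import Mathlib.MeasureTheory.Measure.Haar.InnerProductSpace
import Mathlib.Topology.UniformSpace.LocallyUniformConvergence
import Mathlib.MeasureTheory.Constructions.BorelSpace.Basic
import HarnessLib

/-!
# Route `ExtremiserTransience`, LINE g5-α repair (seat ns-idea-5 g5): PLATEAU PERSISTENCE at ONE time under slice-wise locally uniform convergence

`--supports stmt-NavierStokesRegularity-27822` (`PlateauSliceTransfer`).  Stub S3 `stub_plateauPersistenceSlice` of the v3 («tree-matched») skeleton
for 27822 (evidence file `PlateauSliceTransfer_skeleton_v3.lean`, composition `PlateauSliceTransfer_of3 : S1 → S2 → S3 → PlateauSliceTransfer`), proved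
outright: the fixed-time form of the landed `plateauPersistence` (p635455), matching the SLICE-WISE mode of convergence delivered by the tree's rate-free
KNSS Lemma 6.1 (`Literature…KNSS2009_lemma61_of_oseenMild`) — the v3 cut fixes the plateau at zoom time −1/2 by zooming at the natural Type-I scale, so
joint space-time convergence is no longer needed:

> if `V_k(t₀, ·) → W(t₀, ·)` locally uniformly, the levels `m_k → m₀ > 0`, `δ_k → 0`, every slice `V_k(t₀, ·)` is continuous and bounded by `m_k`, and
> its near-plateau set `{y ∈ B(0,R) : ‖V_k(t₀,y)‖ ≥ (1−δ_k) m_k}` has volume `≥ η > 0`, then `‖W(t₀, ·)‖ ≤ m₀` and `volume{‖W(t₀,·)‖ = m₀} > 0`.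

HONEST FRAMING: an elementary lemma; nothing about Navier–Stokes is proved here and no summit is proved by a line. [folklore]
-/

open scoped Topology
open Filter Set MeasureTheory

namespace Summit.NavierStokesRegularity.NavierStokesRegularity.Theorems.ExtremiserTransience
set_option linter.dupNamespace false

/-- **Plateau persistence at one time** (stub S3 of the v3 skeleton for 27822, verbatim statement). [folklore] -/
theorem plateauPersistenceSlice : ∀ (V : ℕ → ℝ → EuclideanSpace ℝ (Fin 3) → EuclideanSpace ℝ (Fin 3)) (W : ℝ → EuclideanSpace ℝ (Fin 3) → EuclideanSpace ℝ (Fin 3)) (m δ : ℕ → ℝ) (η R t₀ m₀ : ℝ), TendstoLocallyUniformly (fun k => V k t₀) (W t₀) Filter.atTop → 0 < η → 0 < m₀ → (∀ k, Continuous (V k t₀) ∧ (∀ y, ‖V k t₀ y‖ ≤ m k) ∧ ENNReal.ofReal η ≤ MeasureTheory.volume {y : EuclideanSpace ℝ (Fin 3) | y ∈ Metric.ball 0 R ∧ (1 - δ k) * m k ≤ ‖V k t₀ y‖}) → Filter.Tendsto m Filter.atTop (nhds m₀) → Filter.Tendsto δ Filter.atTop (nhds 0) → (∀ y, ‖W t₀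 y‖ ≤ m₀) ∧ 0 < MeasureTheory.volume {y : EuclideanSpace ℝ (Fin 3) | ‖W t₀ y‖ = m₀} := by
  intro V W m δ η R t₀ m₀ hconv hη hm₀ hk hm hδ
  -- pointwise convergence of the slices at the fixed time
  have hpt : ∀ y, Tendsto (fun k => V k t₀ y) atTop (𝓝 (W t₀ y)) := fun y =>
    (hconv.tendstoLocallyUniformlyOn (s := univ)).tendsto_at (mem_univ y)
  -- (1) the slice sup bound passes to the limit
  have h1 : ∀ y, ‖W t₀ y‖ ≤ m₀ := fun y =>
    le_of_tendsto_of_tendsto (hpt y).norm hm (Eventually.of_forall fun k => (hk k).2.1 y)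
  refine ⟨h1, ?_⟩
  -- (2) the near-plateau sets and their limsup
  set P : ℕ → Set (EuclideanSpace ℝ (Fin 3)) :=
    fun k => {y | y ∈ Metric.ball (0 : EuclideanSpace ℝ (Fin 3)) R ∧ (1 - δ k) * m k ≤ ‖V k t₀ y‖} with hP
  have hPmeas : ∀ k, MeasurableSet (P k) := by
    intro k
    have hc : Continuous fun y => ‖V k t₀ y‖ := (hk k).1.norm
    have : P k = Metric.ball 0 R ∩ {y | (1 - δ k) * m k ≤ ‖V k t₀ y‖} := by
      ext y; simp [hP]
    rw [this]
    exact Metric.isOpen_ball.measurableSet.inter (measurableSet_le measurable_const hc.measurable)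
  set B : ℕ → Set (EuclideanSpace ℝ (Fin 3)) := fun n => ⋃ k, ⋃ (_ : n ≤ k), P k with hB
  have hBmeas : ∀ n, MeasurableSet (B n) := fun n =>
    MeasurableSet.iUnion fun k => MeasurableSet.iUnion fun _ => hPmeas k
  have hBanti : Antitone B := by
    intro n n' hnn' y hy
    simp only [hB, mem_iUnion] at hy ⊢
    obtain ⟨k, hk', hyk⟩ := hy
    exact ⟨k, hnn'.trans hk', hyk⟩
  have hBsub : ∀ n, B n ⊆ Metric.ball 0 R := by
    intro n y hy
    simp only [hB, mem_iUnion] at hy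
    obtain ⟨k, -, hyk⟩ := hy
    exact hyk.1
  have hBfin : volume (B 0) ≠ ⊤ :=
    (lt_of_le_of_lt (measure_mono (hBsub 0)) Metric.isBounded_ball.measure_lt_top).ne
  have hlim : Tendsto (fun n => volume (B n)) atTop (𝓝 (volume (⋂ n, B n))) :=
    tendsto_measure_iInter_atTop (fun n => (hBmeas n).nullMeasurableSet) hBanti ⟨0, hBfin⟩
  have hge : ∀ n, ENNReal.ofReal η ≤ volume (B n) := by
    intro n
    refine ((hk n).2.2).trans (measure_mono ?_)
    intro y hy
    simp only [hB, mem_iUnion]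
    exact ⟨n, le_rfl, hy⟩
  have hcap : ENNReal.ofReal η ≤ volume (⋂ n, B n) := ge_of_tendsto hlim (Eventually.of_forall hge)
  -- (3) limsup of the near-plateau sets lies in the exact plateau
  have hincl : (⋂ n, B n) ⊆ {y | ‖W t₀ y‖ = m₀} := by
    intro y hy
    simp only [mem_iInter, hB, mem_iUnion] at hy
    refine le_antisymm (h1 y) ?_
    by_contra hlt
    push Not at hlt
    set ε : ℝ := (m₀ - ‖W t₀ y‖) / 2 with hε
    have hεpos : 0 < ε := by rw [hε]; linarith
    have hevV : ∀ᶠ k in atTop, ‖V k t₀ y‖ < ‖W t₀ y‖ + ε :=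
      (hpt y).norm.eventually (Iio_mem_nhds (by linarith))
    have hprod : Tendsto (fun k => (1 - δ k) * m k) atTop (𝓝 m₀) := by
      have := (tendsto_const_nhds (x := (1 : ℝ)).sub hδ).mul hm
      simpa using this
    have hevL : ∀ᶠ k in atTop, m₀ - ε < (1 - δ k) * m k := hprod.eventually (Ioi_mem_nhds (by linarith))
    obtain ⟨N, hN⟩ := (hevV.and hevL).exists_forall_of_atTop
    obtain ⟨k, hNk, hyk⟩ := hy N
    have hk1 := (hN k hNk).1
    have hk2 := (hN k hNk).2
    have hyk2 : (1 - δ k) * m k ≤ ‖V k t₀ y‖ := hyk.2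
    rw [hε] at hk1 hk2
    linarith
  have hpos : 0 < ENNReal.ofReal η := ENNReal.ofReal_pos.2 hη
  exact lt_of_lt_of_le (lt_of_lt_of_le hpos hcap) (measure_mono hincl)

end Summit.NavierStokesRegularity.NavierStokesRegularity.Theorems.ExtremiserTransience
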